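import Mathlib
import Literature.NumberTheory.LFunctions.WeilMarkovQuadratic
import Literature.NumberTheory.LFunctions.WeilWindowSuzukiProofs
import HarnessLib

/-!
# The archimedean tail `∫_{2b}^∞ e^{t/2}/(2 sinh t) dt` in closed form

Stub `stub_archTail` for the line *parity–multiplicity–commutator* of the crux
`GroundStateSimpleEven` (Weil ground state). The archimedean jump density
`ρ(t) = weilArchDensity t = e^{t/2}/(2 sinh t)` of the Markov form of Weil's quadratic functional
has, with `y = e^{t/2} > 1`, the form `ρ = y³/(y⁴ − 1)` and the primitive
`Φ(t) = arctan(e^{t/2}) − ½ log((e^{t/2} + 1)/(e^{t/2} − 1))` on `(0, ∞)`; since `Φ → π/2` at `+∞`,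
the improper fundamental theorem of calculus gives
`∫_{2b}^∞ ρ = π/2 − arctan(e^b) + ½ log((e^b + 1)/(e^b − 1))` for `b > 0`.
-/

open Set MeasureTheory Filter

open scoped Real Topology

open Literature.NumberTheory.LFunctions

namespace Summit.RiemannHypothesis.RiemannHypothesis.Theorems.GroundStateSimpleEven

set_option linter.dupNamespace false in
/-- `ρ(t) = y³/(y⁴ − 1)` with `y = e^{t/2}`, for `t > 0`. [folklore] -/
theorem tail_weilArchDensity_eq (t : ℝ) (ht : 0 < t) :
    weilArchDensity t = Real.exp (t / 2) ^ 3 / (Real.exp (t / 2) ^ 4 - 1) := by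
  have hy1 : 1 < Real.exp (t / 2) := Real.one_lt_exp_iff.2 (by linarith)
  have hy : 0 < Real.exp (t / 2) := Real.exp_pos _
  have h2 : Real.exp (t / 2) ^ 2 = Real.exp t := by
    rw [sq, ← Real.exp_add, add_halves]
  have h4 : Real.exp (t / 2) ^ 4 = Real.exp t * Real.exp t := by
    rw [show (4 : ℕ) = 2 * 2 from rfl, pow_mul, h2, sq]
  have hinv : Real.exp (-t) * Real.exp t = 1 := by
    rw [← Real.exp_add, neg_add_cancel, Real.exp_zero]
  have hne : Real.exp (t / 2) ^ 4 - 1 ≠ 0 := (sub_pos.2 (one_lt_pow₀ hy1 four_ne_zero)).ne'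
  have hsinh : 2 * Real.sinh t = (Real.exp (t / 2) ^ 4 - 1) / Real.exp (t / 2) ^ 2 := by
    rw [eq_div_iff (pow_ne_zero 2 hy.ne'), h4, h2, Real.sinh_eq]
    linear_combination -hinv
  unfold weilArchDensity
  rw [hsinh, div_div_eq_mul_div, div_eq_div_iff hne hne]
  ring

set_option linter.dupNamespace false in
/-- The primitive `Φ(t) = arctan(e^{t/2}) − ½ log((e^{t/2} + 1)/(e^{t/2} − 1))` has `Φ' = ρ` on
`(0, ∞)`. [folklore] -/
theorem tail_hasDerivAt_primitive {t : ℝ} (ht : 0 < t) :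
    HasDerivAt (fun s : ℝ ↦ Real.arctan (Real.exp (s / 2)) -
        Real.log ((Real.exp (s / 2) + 1) / (Real.exp (s / 2) - 1)) / 2) (weilArchDensity t) t := by
  have hy1 : 1 < Real.exp (t / 2) := Real.one_lt_exp_iff.2 (by linarith)
  have hy : 0 < Real.exp (t / 2) := Real.exp_pos _
  have hm : Real.exp (t / 2) - 1 ≠ 0 := (sub_pos.2 hy1).ne'
  have hp : Real.exp (t / 2) + 1 ≠ 0 := by positivity
  have hq : (Real.exp (t / 2) + 1) / (Real.exp (t / 2) - 1) ≠ 0 := div_ne_zero hp hm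
  have hsq : 1 + Real.exp (t / 2) ^ 2 ≠ 0 := by positivity
  have hne : Real.exp (t / 2) ^ 4 - 1 ≠ 0 := (sub_pos.2 (one_lt_pow₀ hy1 four_ne_zero)).ne'
  have he : HasDerivAt (fun s : ℝ ↦ Real.exp (s / 2)) (Real.exp (t / 2) * (1 / 2)) t :=
    ((hasDerivAt_id t).div_const 2).exp
  have hquot := (he.add_const 1).div (he.sub_const 1) hm
  have hall := he.arctan.sub ((hquot.log hq).div_const 2)
  refine hall.congr_deriv ?_
  rw [Pi.div_apply, tail_weilArchDensity_eq t ht]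
  field_simp
  ring

set_option linter.dupNamespace false in
/-- `Φ(t) → π/2` as `t → +∞` (`arctan(e^{t/2}) → π/2`, `(e^{t/2}+1)/(e^{t/2}−1) → 1`). [folklore] -/
theorem tail_tendsto_primitive :
    Tendsto (fun s : ℝ ↦ Real.arctan (Real.exp (s / 2)) -
        Real.log ((Real.exp (s / 2) + 1) / (Real.exp (s / 2) - 1)) / 2) atTop (𝓝 (Real.pi / 2)) := by
  have he : Tendsto (fun s : ℝ ↦ Real.exp (s / 2)) atTop atTop :=
    Real.tendsto_exp_atTop.comp (tendsto_id.atTop_div_const (by norm_num : (0 : ℝ) < 2))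
  have harc : Tendsto (fun s : ℝ ↦ Real.arctan (Real.exp (s / 2))) atTop (𝓝 (Real.pi / 2)) :=
    (Real.tendsto_arctan_atTop.mono_right nhdsWithin_le_nhds).comp he
  have hq : Tendsto (fun s : ℝ ↦ (Real.exp (s / 2) + 1) / (Real.exp (s / 2) - 1)) atTop (𝓝 1) := by
    have h1 : Tendsto (fun s : ℝ ↦ 1 + 2 / (Real.exp (s / 2) - 1)) atTop (𝓝 (1 + 0)) :=
      tendsto_const_nhds.add
        (tendsto_const_nhds.div_atTop (tendsto_atTop_add_const_right _ (-1) he))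
    rw [add_zero] at h1
    refine h1.congr' ?_
    filter_upwards [eventually_gt_atTop 0] with s hs
    have hm : Real.exp (s / 2) - 1 ≠ 0 :=
      (sub_pos.2 (Real.one_lt_exp_iff.2 (by linarith))).ne'
    field_simp
    ring
  have hlog : Tendsto (fun s : ℝ ↦ Real.log ((Real.exp (s / 2) + 1) / (Real.exp (s / 2) - 1)))
      atTop (𝓝 0) := by
    simpa using hq.log one_ne_zero
  simpa using harc.sub (hlog.div_const 2)

end Summit.RiemannHypothesis.RiemannHypothesis.Theorems.GroundStateSimpleEven

namespace Summit.RiemannHypothesis.RiemannHypothesis.Theorems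

set_option linter.dupNamespace false in
/-- **Archimedean tail in closed form**: for `b > 0` the density `ρ(t) = e^{t/2}/(2 sinh t)` is
integrable on `(2b, ∞)` and `∫_{2b}^∞ ρ = π/2 − arctan(e^b) + ½ log((e^b + 1)/(e^b − 1))`
(improper FTC with the primitive `arctan(e^{t/2}) − ½ log((e^{t/2}+1)/(e^{t/2}−1)) → π/2`).
[folklore] -/
theorem stub_archTail :
    ∀ b : ℝ, 0 < b → IntegrableOn weilArchDensity (Ioi (2 * b)) ∧
      ∫ t in Ioi (2 * b), weilArchDensity t =
        Real.pi / 2 - Real.arctan (Real.exp b) +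
          Real.log ((Real.exp b + 1) / (Real.exp b - 1)) / 2 := by
  intro b hb
  have h2b : 0 < 2 * b := by positivity
  refine ⟨integrableOn_weilArchDensity_Ioi h2b, ?_⟩
  rw [integral_Ioi_of_hasDerivAt_of_tendsto
    (GroundStateSimpleEven.tail_hasDerivAt_primitive h2b).continuousAt.continuousWithinAt
    (fun t ht ↦ GroundStateSimpleEven.tail_hasDerivAt_primitive (h2b.trans ht))
    (integrableOn_weilArchDensity_Ioi h2b) GroundStateSimpleEven.tail_tendsto_primitive]
  have h : 2 * b / 2 = b := by ring
  simp only [h]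
  ring

end Summit.RiemannHypothesis.RiemannHypothesis.Theorems
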